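import Literature.NumberTheory.LFunctions.ClassGroupCharacterEulerProduct
import Literature.NumberTheory.LFunctions.ClassGroupLFunctionInversion
import Literature.NumberTheory.LFunctions.TwistedDedekindCoefficients
import HarnessLib

/-!
# Class group characters as completely multiplicative functions on ideals:
# `−L'/L(s, χ) = Σ_n (Σ_{N𝔞 = n} χ([𝔞]) Λ(𝔞)) n^{-s}` and the `3–4–1` inequality

Topic `Literature/NumberTheory/LFunctions` (namespace `Literature.NumberTheory.LFunctions.NumberField`),
continuing `ClassGroupCharacterEulerProduct.lean` (`L(s, χ)` as the ray class `L`-series `mod 1`,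
`classGroupLFunction_eq_LSeries`) with the tree's twisted Dedekind coefficients
(`TwistedDedekindCoefficients.lean`: for a completely multiplicative `ν : Ideal(𝓞 K) →*₀ ℂ` with
`|ν| ≤ 1`, the coefficients `twistCount ν`, `twistVonMangoldt ν` of `L(s, ν)` and `−L'/L(s, ν)`,
`logDeriv_LSeries_twistCount`, and Montgomery–Vaughan's Lemma 11.2 over `K`, `three_four_one`).
Everything here is PROVED (one definition with body, theorems).

* `classGroupCharIdealHom χ : Ideal (𝓞 K) →*₀ ℂ` — `ν_χ(𝔞) = χ([𝔞])` (`𝔞 ≠ 0`), `ν_χ(0) = 0`;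
  `|ν_χ| ≤ 1`; `ν_{χ²} = ν_χ²`;
* `LSeries_twistCount_classGroupCharIdealHom` — `L(twistCount ν_χ, s) = L(s, χ)` for `Re s > 1`;
* `neg_logDeriv_classGroupLFunction_eq` — **`−L'/L(s, χ) = Σ_n Λ_χ(n) n^{-s}`** for `Re s > 1`,
  `Λ_χ(n) = Σ_{N𝔞 = n} χ([𝔞]) Λ(𝔞)` (= `twistVonMangoldt ν_χ`) — the Dirichlet series entering the
  Mellin inversion (4.2) of [ThornerZaman2019, Lemma 4.3] for `L(s, χ, H_K/K)`;
* `three_four_one_classGroupChar` — `3 Re(−ζ_K'/ζ_K)(σ) + 4 Re(−L'/L)(σ + it, χ) + Re(−L'/L)(σ + 2it, χ²) ≥ 0`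
  for `σ > 1` (the positivity input of the zero-free region, [ThornerZaman2019, Thm. 3.1] via
  Montgomery–Vaughan §11.1 / [Weiss]).

## References

* H. L. Montgomery, R. C. Vaughan, *Multiplicative Number Theory I*, CUP 2007, §11.1, Lemma 11.2.
  [MontgomeryVaughan2007]
* J. Thorner, A. Zaman, *A unified and improved Chebotarev density theorem*, ANT 13 (2019), §2.3,
  §3, §4.2. [ThornerZaman2019]
-/

noncomputable section

open scoped NumberField nonZeroDivisors
open Complex Filter Topology NumberField

namespace Literature.NumberTheory.LFunctions.NumberField

variable {K : Type*} [Field K] [NumberField K]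

/-! ### The completely multiplicative function `ν_χ` on ideals -/

open scoped Classical in
/-- The completely multiplicative function on the ideals of `𝓞 K` attached to a class group
character: `ν_χ(𝔞) = χ([𝔞])` for `𝔞 ≠ 0` and `ν_χ(0) = 0` (a `MonoidWithZeroHom`, the shape
consumed by the tree's `TwistedDedekindCoefficients.lean`). [cite: ThornerZaman2019, §2.3] -/
def classGroupCharIdealHom (χ : ClassGroup (𝓞 K) →* ℂˣ) : Ideal (𝓞 K) →*₀ ℂ where
  toFun I := if h : I = ⊥ then 0 else (χ (ClassGroup.mk0 ⟨I, mem_nonZeroDivisors_of_ne_zero h⟩) : ℂ)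
  map_zero' := by simp
  map_one' := by
    have h1 : (1 : Ideal (𝓞 K)) ≠ ⊥ := by rw [Ideal.one_eq_top]; exact top_ne_bot
    rw [dif_neg h1]
    rw [show (⟨(1 : Ideal (𝓞 K)), mem_nonZeroDivisors_of_ne_zero h1⟩ : (Ideal (𝓞 K))⁰) = 1 from rfl,
      map_one, map_one, Units.val_one]
  map_mul' I J := by
    by_cases hI : I = ⊥
    · simp [hI]
    by_cases hJ : J = ⊥
    · simp [hJ]
    have hIJ : I * J ≠ ⊥ := by rw [Ne, Ideal.mul_eq_bot]; tauto
    rw [dif_neg hIJ, dif_neg hI, dif_neg hJ, ← Units.val_mul, ← map_mul, ← map_mul]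
    rfl

/-- `ν_χ(𝔞) = χ([𝔞])` for `𝔞 ≠ 0`. [folklore] -/
theorem classGroupCharIdealHom_apply_of_ne_bot (χ : ClassGroup (𝓞 K) →* ℂˣ) {I : Ideal (𝓞 K)}
    (hI : I ≠ ⊥) :
    classGroupCharIdealHom χ I = χ (ClassGroup.mk0 ⟨I, mem_nonZeroDivisors_of_ne_zero hI⟩) := by
  classical
  simp only [classGroupCharIdealHom, MonoidWithZeroHom.coe_mk, ZeroHom.coe_mk, dif_neg hI]

/-- The same, indexed by the nonzero ideals. [folklore] -/
theorem classGroupCharIdealHom_coe (χ : ClassGroup (𝓞 K) →* ℂˣ) (I : (Ideal (𝓞 K))⁰) :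
    classGroupCharIdealHom χ I = χ (ClassGroup.mk0 I) := by
  rw [classGroupCharIdealHom_apply_of_ne_bot χ (nonZeroDivisors.ne_zero I.2)]

/-- `ν_χ(0) = 0`. [folklore] -/
theorem classGroupCharIdealHom_bot (χ : ClassGroup (𝓞 K) →* ℂˣ) :
    classGroupCharIdealHom χ ⊥ = 0 := map_bot _

/-- `|ν_χ(𝔞)| ≤ 1`. [folklore] -/
theorem norm_classGroupCharIdealHom_le (χ : ClassGroup (𝓞 K) →* ℂˣ) (I : Ideal (𝓞 K)) :
    ‖classGroupCharIdealHom χ I‖ ≤ 1 := by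
  by_cases hI : I = ⊥
  · rw [hI, classGroupCharIdealHom_bot, norm_zero]; exact zero_le_one
  · rw [classGroupCharIdealHom_apply_of_ne_bot χ hI, norm_classGroupChar_apply]

/-- `ν_{χ²} = ν_χ²` pointwise. [folklore] -/
theorem classGroupCharIdealHom_mul_self (χ : ClassGroup (𝓞 K) →* ℂˣ) (I : Ideal (𝓞 K)) :
    classGroupCharIdealHom (χ * χ) I = classGroupCharIdealHom χ I ^ 2 := by
  by_cases hI : I = ⊥
  · rw [hI, classGroupCharIdealHom_bot, classGroupCharIdealHom_bot]; ring
  · rw [classGroupCharIdealHom_apply_of_ne_bot _ hI, classGroupCharIdealHom_apply_of_ne_bot _ hI,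
      MonoidHom.mul_apply, Units.val_mul, sq]

/-- `ν_χ = rayClassCoeff ⊤ ψ_χ` (both are `χ([𝔞])` off `0`, and `0` at `0`). [folklore] -/
theorem classGroupCharIdealHom_eq_rayClassCoeff (χ : ClassGroup (𝓞 K) →* ℂˣ) (I : Ideal (𝓞 K)) :
    classGroupCharIdealHom χ I = rayClassCoeff ⊤ (classGroupCharPrimeValue χ) I := by
  by_cases hI : I = ⊥
  · rw [hI, classGroupCharIdealHom_bot, rayClassCoeff_bot]
  · rw [classGroupCharIdealHom_apply_of_ne_bot χ hI, rayClassCoeff_top_of_ne_bot χ hI]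

/-! ### `L`-series identities on `Re s > 1` -/

variable (K) in
/-- **`L(twistCount ν_χ, s) = L(s, χ)`** for `Re s > 1`. [cite: ThornerZaman2019, §2.3] -/
theorem LSeries_twistCount_classGroupCharIdealHom (χ : ClassGroup (𝓞 K) →* ℂˣ) {s : ℂ}
    (hs : 1 < s.re) :
    LSeries (twistCount K (classGroupCharIdealHom χ)) s = classGroupLFunction K χ s := by
  rw [classGroupLFunction_eq_LSeries K χ hs]
  refine LSeries_congr (fun {n} _ ↦ ?_) s
  rw [twistCount, idealsOfNorm]
  exact Finset.sum_congr rfl fun I _ ↦ classGroupCharIdealHom_eq_rayClassCoeff χ I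

variable (K) in
/-- `L(twistCount ν_χ, ·)` and `L(·, χ)` agree on the open half-plane `Re s > 1`, hence have the same
derivative there. [folklore] -/
theorem deriv_LSeries_twistCount_classGroupCharIdealHom (χ : ClassGroup (𝓞 K) →* ℂˣ) {s : ℂ}
    (hs : 1 < s.re) :
    deriv (LSeries (twistCount K (classGroupCharIdealHom χ))) s =
      deriv (classGroupLFunction K χ) s := by
  refine Filter.EventuallyEq.deriv_eq ?_
  have ho : IsOpen {z : ℂ | 1 < z.re} := isOpen_lt continuous_const Complex.continuous_re
  filter_upwards [ho.mem_nhds hs] with z hz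
  exact LSeries_twistCount_classGroupCharIdealHom K χ hz

variable (K) in
/-- **`−L'/L(s, χ) = Σ_n Λ_χ(n) n^{-s}`** for `Re s > 1`, with
`Λ_χ(n) = Σ_{N𝔞 = n} χ([𝔞]) Λ(𝔞) = twistVonMangoldt ν_χ n` (the tree's
`logDeriv_LSeries_twistCount`, transported along `LSeries_twistCount_classGroupCharIdealHom`).
[cite: ThornerZaman2019, §4.2 (4.2)] -/
theorem neg_logDeriv_classGroupLFunction_eq (χ : ClassGroup (𝓞 K) →* ℂˣ) {s : ℂ} (hs : 1 < s.re) :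
    -(deriv (classGroupLFunction K χ) s / classGroupLFunction K χ s) =
      LSeries (twistVonMangoldt K (classGroupCharIdealHom χ)) s := by
  have h := logDeriv_LSeries_twistCount (norm_classGroupCharIdealHom_le χ) hs
  rw [deriv_LSeries_twistCount_classGroupCharIdealHom K χ hs,
    LSeries_twistCount_classGroupCharIdealHom K χ hs] at h
  rw [h, neg_neg]

variable (K) in
/-- `−L'(s, χ) = L(Λ_χ, s) · L(s, χ)` for `Re s > 1`. [folklore] -/
theorem deriv_classGroupLFunction_eq (χ : ClassGroup (𝓞 K) →* ℂˣ) {s : ℂ} (hs : 1 < s.re) :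
    deriv (classGroupLFunction K χ) s =
      -(LSeries (twistVonMangoldt K (classGroupCharIdealHom χ)) s * classGroupLFunction K χ s) := by
  have h := deriv_LSeries_twistCount (norm_classGroupCharIdealHom_le χ) hs
  rwa [deriv_LSeries_twistCount_classGroupCharIdealHom K χ hs,
    LSeries_twistCount_classGroupCharIdealHom K χ hs] at h

/-! ### The `3–4–1` inequality -/

variable (K) in
/-- **Montgomery–Vaughan Lemma 11.2 for class group characters**: for `σ > 1` and real `t`,
`3 Re L(Λ_K, σ) + 4 Re L(Λ_χ, σ + it) + Re L(Λ_{χ²}, σ + 2it) ≥ 0`, i.e.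
`3 Re(−ζ_K'/ζ_K)(σ) + 4 Re(−L'/L)(σ + it, χ) + Re(−L'/L)(σ + 2it, χ²) ≥ 0` — the positivity
behind the zero-free region [ThornerZaman2019, Thm. 3.1]. [cite: MontgomeryVaughan2007, Lemma 11.2] -/
theorem three_four_one_classGroupChar (χ : ClassGroup (𝓞 K) →* ℂˣ) {σ : ℝ} (hσ : 1 < σ) (t : ℝ) :
    0 ≤ 3 * (LSeries (fun n ↦ (vonMangoldtNorm K n : ℂ)) σ).re +
      4 * (LSeries (twistVonMangoldt K (classGroupCharIdealHom χ)) (σ + t * I)).re +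
        (LSeries (twistVonMangoldt K (classGroupCharIdealHom (χ * χ))) (σ + 2 * t * I)).re :=
  three_four_one (norm_classGroupCharIdealHom_le χ) (classGroupCharIdealHom_mul_self χ) hσ t

end Literature.NumberTheory.LFunctions.NumberField

end
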